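import Summits.HodgeConjecture.HodgeCM.Model.ToyG2.EigenForms_1

/-! PORT of `HodgeCM/Model/ToyG2/EigenForms.lean` (HodgeCMPerL run 82) — part 2: continuation of `Summits.HodgeConjecture.HodgeCM.Model.ToyG2.EigenForms_1` (split at a top-level declaration boundary by port_pkg.py; scope re-opened below; declarations unchanged). -/

-- port_pkg: scope re-opened for this part (file-level context, then the namespace/section stack open at the cut)
open scoped TensorProduct ComplexConjugate
open HodgeCM.Toy HodgeCM.Toy.CMPresentation exteriorPower NumberField.ComplexEmbedding
open Literature.AlgebraicGeometry.Motives
open Literature.AlgebraicGeometry.ShimuraVarieties (conjRingHomK)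
namespace HodgeCM.ToyG2
noncomputable section
section Block
variable (L : CMField) (Θ : Fin 4 → CMType L) (ξ : Fin 4 → L) (d t : ℚ)
/-- (Ported verbatim from the HodgeCMPerL package; no docstring in the source.) -/
theorem conjugate_comp_eK (τ : FK L →+* ℂ) :
    (conjugate τ).comp (eK L : L →+* FK L) = conjugate (τ.comp (eK L : L →+* FK L)) :=
  RingHom.ext fun x => by simp [conjugate_coe_eq]

/-- the conjugate character is holomorphic iff the character is not -/
theorem conjugate_comp_mem_iff (τ : FK L →+* ℂ) (a : Fin 4) :
    (conjugate τ).comp (eK L : L →+* FK L) ∈ (Θ a).1 ↔ ¬ τ.comp (eK L : L →+* FK L) ∈ (Θ a).1 := by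
  rw [conjugate_comp_eK]
  have h := (Θ a).2 (τ.comp (eK L : L →+* FK L))
  exact ⟨fun hq hp => (h.mp hp) hq, fun hnp => Classical.byContradiction fun hnq => hnp (h.mpr hnq)⟩

/-- VANISHING (rational): if no two slots are each hit twice and some slot is missed, `ℓ = 0`
on the corresponding slot family. -/
theorem ell_emb_eq_zero (s : Fin 4 → Fin 4) (x : Fin 4 → FK L)
    (hE : ∀ a b : Fin 4, a ≠ b →
      (Finset.univ.filter fun k => s k = a).card < 2 ∨ (Finset.univ.filter fun k => s k = b).card < 2)
    (hT : ∃ k₀ : Fin 4, ∀ k, s k ≠ k₀) :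
    ell L Θ ξ d t (fun k => emb L Θ (s k) (x k)) = 0 := by
  classical
  have hEE : ∀ a b : Fin 4, a ≠ b → EE L Θ ξ a b (fun k => emb L Θ (s k) (x k)) = 0 := by
    intro a b hab
    rcases hE a b hab with ha | hb
    · refine EE_eq_zero_left L Θ ξ a b _ _ ha fun k hk => ?_
      rw [Finset.mem_filter, not_and] at hk
      exact pr_emb_of_ne L Θ (hk (Finset.mem_univ k)) (x k)
    · refine EE_eq_zero_right L Θ ξ a b _ _ hb fun k hk => ?_
      rw [Finset.mem_filter, not_and] at hk
      exact pr_emb_of_ne L Θ (hk (Finset.mem_univ k)) (x k)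
  have hTT : TT L Θ ξ (fun k => emb L Θ (s k) (x k)) = 0 := by
    obtain ⟨k₀, hk₀⟩ := hT
    exact TT_eq_zero_of_slot_missing L Θ ξ _ k₀ fun k => pr_emb_of_ne L Θ (hk₀ k) (x k)
  simp only [ell, AlternatingMap.add_apply, AlternatingMap.smul_apply, hTT, smul_zero, add_zero,
    hEE 0 1 (by decide), hEE 2 3 (by decide), hEE 0 2 (by decide), hEE 0 3 (by decide),
    hEE 1 2 (by decide), hEE 1 3 (by decide)]

/-- VANISHING (complex): the same for eigenvector monomials. -/
theorem baseC_ell_mono_eq_zero (s : Fin 4 → Fin 4) (τ : Fin 4 → (FK L →+* ℂ))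
    (hE : ∀ a b : Fin 4, a ≠ b →
      (Finset.univ.filter fun k => s k = a).card < 2 ∨ (Finset.univ.filter fun k => s k = b).card < 2)
    (hT : ∃ k₀ : Fin 4, ∀ k, s k ≠ k₀) :
    baseC (PP L Θ) (ellLin L Θ ξ d t) ((PP L Θ).mono 4 (fun j => ix L Θ (τ j) (s j))) = 0 := by
  rw [baseC_mono]
  simp_rw [eB_ix]
  rw [baseCA_expand]
  refine Finset.sum_eq_zero fun M _ => ?_
  rw [ellLin_apply_ιMulti, ell_emb_eq_zero L Θ ξ d t s _ hE hT, Rat.cast_zero, mul_zero]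

/-- antisymmetry in the index family -/
theorem mono_comp_perm (X : Obj) (k : ℕ) (g : Fin k → X.Idx) (σ : Equiv.Perm (Fin k)) :
    X.mono k (g ∘ σ) = Equiv.Perm.sign σ • X.mono k g := by
  rw [Obj.mono_def, Obj.mono_def]
  exact AlternatingMap.map_perm (ιMulti ℂ k) (X.eB ∘ g) σ

/-- (Ported verbatim from the HodgeCMPerL package; no docstring in the source.) -/
theorem cnt_comp_perm (X : Obj) {k : ℕ} (g : Fin k → X.Idx) (σ : Equiv.Perm (Fin k)) :
    X.cnt (g ∘ σ) = X.cnt g := by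
  classical
  rw [Obj.cnt_eq_card_filter, Obj.cnt_eq_card_filter]
  exact Finset.card_equiv σ fun j => by simp

end Block

end

end HodgeCM.ToyG2
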